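import Summits.Ventures.LatticeQCDFlow.Scaling.FiniteOddsLumpedLaw
import Summits.Ventures.LatticeQCDFlow.Scaling.WeightedPathCoupling
import Summits.Ventures.LatticeQCDFlow.Scaling.AdjacentPathBound

/-!
HONEST FRAMING: exact (Metropolis-corrected) sampling algorithms for lattice gauge theory; figures
of merit are autocorrelation/cost numbers at stated couplings and volumes; no continuum-physics
claim.

# FiniteOddsAdjacentLaw — THE PATH-COUPLING REDUCTION: THE LAW OF THE LUMPED STAR AT SWAP ODDS `σ` (CHAPTER W FILE 7) NEEDS THE PERSISTENCE INEQUALITY ON ADJACENT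
# EQUAL-HUB PAIRS ONLY (`Δ(comp x, comp y) = 1`, I.E. `N_Y = N_X − δ_a + δ_b`): `d(n) ≤ ((K+1)(c+2K+2) + 2(K+1)(c+2K+6))·(1−ρ)ⁿ` (lean-2 GEN-37, ours)

Venture-side (OURS).  Cell `lqcd-flow` (pub-lqcd), unit `pub-lqcd-lean-2-g37`, 2026-08-29.  Chapter W (item 1 (i) at finite swap odds), file 19 = files 17 + 18 assembled on the cycle
chain of chapter V file 9 ∕ chapter W file 2.  §1 (`lumpedAdjacent_worstTvDist_le`) is chapter W file 2's `lumpedAny_worstTvDist_le` with the equal-hub criterion required on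
ADJACENT pairs only: edges = adjacent equal-hub pairs (length `F`) and unequal-hub pairs (length `C`); by file 18 the path pseudo-metric `d` of file 17 is `≤ Δ·F` on equal-hub
pairs (`≤ C` otherwise), every edge has length `≥ 1`, and the one-step image of `Ψ = Δ·F + C·𝟙{hubs differ}` under the coupled cycle chain (file 2's `lumpedAny_mulVec_potential`)
bounds `E[d(X',Y')]`; the criterion on adjacent pairs and the crude bound on unequal-hub pairs are exactly edge contraction against the edge length, so file 17 gives
`d(n) ≤ ((K+1)F_max + C)(1−ρ)ⁿ`.  §2 (`finiteOdds_adjacent_worstTvDist_le`) is chapter W file 7's conditional law VERBATIM except that the persistence inequality `hpers` is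
assumed on adjacent equal-hub pairs only — with files 14–16 this makes the law of item 1 (i) at every swap rate a consequence of the two comparison conjectures (D), (S2) of
MEMO-gen37 on the tagged chains.  Hypothesis-equations, no definitions.

## What is proved

* `graphPath_mono`, **`lumpedAdjacent_worstTvDist_le`**, **`finiteOdds_adjacent_worstTvDist_le`**.

Reading (no numerics implied): Bubley–Dyer for the product potential.  NOT CLAIMED: the persistence inequality.  Literature grade (cell rule): OWN on the tree's LPW files; nothing
cited as a fact; no new bib keys.
-/

open Finset Matrix
open Literature.Probability.MarkovChains

namespace Summit.Ventures.LatticeQCDFlow.Scaling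

section Mono
variable {X : Type*} {E E' : X → X → Prop} {ℓ ℓ' : X → X → ℝ}

/-- A path in a subgraph with the same lengths is a path in the graph. [ours] -/
theorem graphPath_mono (hEE : ∀ a b, E' a b → E a b ∧ ℓ a b = ℓ' a b) {x y : X} {L : ℝ} (h : IsGraphPath E' ℓ' x y L) : IsGraphPath E ℓ x y L := by
  induction h with
  | nil x => exact IsGraphPath.nil x
  | @cons a m b L hE _ ih => exact graphPath_cast ((hEE a m hE).2 ▸ IsGraphPath.cons (hEE a m hE).1 ih) rfl

end Mono

section Adjacent
variable {X : Type*} [Fintype X] [DecidableEq X] {S : Type*} [Fintype S] [DecidableEq S]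
variable {hub : X → S} {comp : X → S → ℕ} {K : ℕ} {μ0 r s : S → ℝ} {c C ρ Fmax : ℝ} {u : X → S → ℝ} {q : X → X → S → S → ℝ}
variable {P : X → X → ℝ} {Q : Matrix (X × X) (X × X) ℝ} {Δ : (S → ℕ) → (S → ℕ) → ℕ} {F Ψ : X × X → ℝ}

/-- **THE CYCLE CHAIN WITH ANY END-HUB COUPLINGS: THE EQUAL-HUB CRITERION ON ADJACENT PAIRS SUFFICES** — `d(n) ≤ ((K+1)F_max + C)(1−ρ)ⁿ` (path coupling, files 17–18). [ours] -/
theorem lumpedAdjacent_worstTvDist_le [Nonempty X] (hinj : ∀ x x', hub x = hub x' → comp x = comp x' → x = x') (hsum : ∀ x, ∑ v, comp x v = K + 1)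
    (hsurj : ∀ (z : S) (N : S → ℕ), ∑ v, N v = K + 1 → N z ≠ 0 → ∃ x, hub x = z ∧ comp x = N) (hhub : ∀ x, comp x (hub x) ≠ 0)
    (hμ0 : ∀ v, 0 ≤ μ0 v) (hμ1 : ∑ v, μ0 v = 1) (hu0 : ∀ x a, 0 ≤ u x a) (hu1 : ∀ x, ∑ a, u x a = 1) (hlegal : ∀ x a, u x a ≠ 0 → comp x a ≠ 0)
    (hqc : ∀ x y, IsCoupling (u x) (u y) (q x y))
    (hΔ : ∀ N N', Δ N N' = ∑ v, (N v - N' v))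
    (hP : ∀ x x', P x x' = ∑ a, u x a * (μ0 (hub x') * (if comp x' + Pi.single a 1 = comp x + Pi.single (hub x') 1 then (1 : ℝ) else 0)))
    (hQ : ∀ x y x' y', Q (x, y) (x', y') = ∑ a, ∑ b, q x y a b * (μ0 (hub x')
      * (if comp x' + Pi.single a 1 = comp x + Pi.single (hub x') 1 then (1 : ℝ) else 0))
      * ((if hub y' = hub x' then (1 : ℝ) else 0) * (if comp y' + Pi.single b 1 = comp y + Pi.single (hub y') 1 then (1 : ℝ) else 0)))
    (hF : ∀ x y, F (x, y) = c + s (hub x) + s (hub y) + ∑ v, r v * ((comp x v : ℝ) + (comp y v : ℝ)))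
    (hΨ : ∀ x y, Ψ (x, y) = (Δ (comp x) (comp y) : ℝ) * F (x, y) + C * (if hub x = hub y then (0 : ℝ) else 1))
    (hF1 : ∀ x y, 1 ≤ F (x, y)) (hFmax : ∀ x y, F (x, y) ≤ Fmax) (hC1 : 1 ≤ C) {B : ℝ} (hρ1 : ρ ≤ 1) (hBC : B ≤ (1 - ρ) * C)
    (hB : ∀ x y, ∑ a, ∑ b, q x y a b * ((Δ (comp x - Pi.single a 1) (comp y - Pi.single b 1) : ℝ)
        * (F (x, y) + (2 * ∑ v, μ0 v * s v - s (hub x) - s (hub y) + 2 * ∑ v, μ0 v * r v) - r a - r b)) ≤ B)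
    (hcrit : ∀ x y, hub x = hub y → Δ (comp x) (comp y) = 1 → ∑ a, ∑ b, q x y a b * ((Δ (comp x - Pi.single a 1) (comp y - Pi.single b 1) : ℝ)
        * (F (x, y) + (2 * ∑ v, μ0 v * s v - s (hub x) - s (hub y) + 2 * ∑ v, μ0 v * r v) - r a - r b))
        ≤ (1 - ρ) * ((Δ (comp x) (comp y) : ℝ) * F (x, y)))
    {π : X → ℝ} (hπ : IsStationary π P) (hπ0 : ∀ x, 0 ≤ π x) (hπ1 : ∑ x, π x = 1) (n : ℕ) :
    worstTvDist P π n ≤ ((K + 1) * Fmax + C) * (1 - ρ) ^ n := by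
  classical
  have hPst : IsRowStochastic P := lumped_isRowStochastic hinj hsum hsurj hμ0 hμ1 hu0 hu1 hlegal hP
  have hMC : IsMarkovianCoupling P Q := lumpedAny_isMarkovianCoupling hinj hsum hsurj hμ0 hlegal hqc hP hQ
  have hmv := lumpedAny_mulVec_potential (c := c) (C := C) hinj hsum hsurj hμ1 hlegal hqc hΔ hQ hF hΨ
  -- edges and lengths
  let E : X → X → Prop := fun x y => (hub x = hub y ∧ Δ (comp x) (comp y) = 1) ∨ hub x ≠ hub y
  let ℓ : X → X → ℝ := fun x y => if hub x = hub y then F (x, y) else C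
  have hℓ1 : ∀ a b, E a b → 1 ≤ ℓ a b := by
    intro a b hab; simp only [ℓ]; split_ifs with h
    · exact hF1 a b
    · exact hC1
  have hℓ0 : ∀ a b, E a b → 0 ≤ ℓ a b := fun a b h => zero_le_one.trans (hℓ1 a b h)
  -- paths: equal hubs (file 18), unequal hubs (one edge)
  have hFeq : ∀ x y, hub x = hub y → (fun x y => F (x, y)) x y = (fun z => c + 2 * s z) (hub x) + ∑ v, r v * ((comp x v : ℝ) + (comp y v : ℝ)) := by
    intro x y hxy; simp only [hF x y, hxy]; ring
  have hpathEq := adjacent_path_le (F := fun x y => F (x, y)) (cz := fun z => c + 2 * s z) (θ := r) hinj hsum hsurj hhub hΔ hFeq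
  have hpath : ∀ x y, ∃ L, IsGraphPath E ℓ x y L ∧ L ≤ Ψ (x, y) := by
    intro x y
    by_cases hxy : hub x = hub y
    · obtain ⟨L, hL, hLle⟩ := hpathEq x y hxy
      refine ⟨L, graphPath_mono (fun a b hab => ⟨Or.inl hab, by simp only [ℓ, if_pos hab.1]⟩) hL, ?_⟩
      rw [hΨ, if_pos hxy, mul_zero, add_zero]; exact hLle
    · refine ⟨ℓ x y + 0, IsGraphPath.cons (Or.inr hxy) (IsGraphPath.nil y), ?_⟩
      rw [hΨ, if_neg hxy]; simp only [ℓ, if_neg hxy]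
      have : (0 : ℝ) ≤ (Δ (comp x) (comp y) : ℝ) * F (x, y) := mul_nonneg (Nat.cast_nonneg _) (zero_le_one.trans (hF1 x y))
      linarith
  -- the path pseudo-metric
  obtain ⟨d, hle, happrox⟩ := exists_wpath (E := E) (ℓ := ℓ) hℓ0 (fun x y => by obtain ⟨L, hL, -⟩ := hpath x y; exact ⟨L, hL⟩)
  have hdΨ : ∀ x y, d x y ≤ Ψ (x, y) := fun x y => by obtain ⟨L, hL, hLle⟩ := hpath x y; exact (hle x y L hL).trans hLle
  have hd0 : ∀ x y, 0 ≤ d x y := wpath_nonneg hℓ0 happrox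
  -- Ψ ≤ (K+1)Fmax + C
  have hK0 : (0 : ℝ) ≤ K := Nat.cast_nonneg _
  have hFmax0 : 0 ≤ Fmax := by obtain ⟨x⟩ := ‹Nonempty X›; linarith [hF1 x x, hFmax x x]
  have hΨle : ∀ x y, Ψ (x, y) ≤ (K + 1) * Fmax + C := by
    intro x y
    rw [hΨ]
    have hΔle : (Δ (comp x) (comp y) : ℝ) ≤ K + 1 := by
      have := cdist_le_sum hΔ (comp x) (comp y); rw [hsum] at this; exact_mod_cast this
    have h1 : (Δ (comp x) (comp y) : ℝ) * F (x, y) ≤ (K + 1) * Fmax :=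
      mul_le_mul hΔle (hFmax x y) (zero_le_one.trans (hF1 x y)) (by linarith)
    have h2 : C * (if hub x = hub y then (0 : ℝ) else 1) ≤ C := by split_ifs <;> nlinarith
    linarith
  -- edge contraction against the edge length
  have hedge : ∀ x y, E x y → ∃ θ, IsCoupling (P x) (P y) θ ∧ transportCost d θ ≤ (1 - ρ) * ℓ x y := by
    intro x y hxy
    refine ⟨fun x' y' => Q (x, y) (x', y'), hMC x y, ?_⟩
    -- `E_Q d ≤ E_Q Ψ = (QΨ)(x,y)`
    have hcost : transportCost d (fun x' y' => Q (x, y) (x', y')) ≤ (Q *ᵥ Ψ) (x, y) := by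
      unfold transportCost
      rw [Matrix.mulVec, dotProduct, Fintype.sum_prod_type]
      exact sum_le_sum fun x' _ => sum_le_sum fun y' _ => by
        rw [mul_comm]; exact mul_le_mul_of_nonneg_left (hdΨ x' y') ((hMC x y).1 x' y')
    rw [hmv x y] at hcost
    rcases hxy with ⟨hh, h1⟩ | hh
    · have hc := hcrit x y hh h1
      rw [h1, Nat.cast_one, one_mul] at hc
      simp only [ℓ, if_pos hh]; linarith
    · have hb := hB x y
      simp only [ℓ, if_neg hh]; linarith
  -- path coupling
  have hmain := wpath_worstTvDist_le hPst hℓ1 hle happrox (c := 1 - ρ) (by linarith) hedge hπ0 hπ1 hπ n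
  have hdiam : rhoDiam d ≤ (K + 1) * Fmax + C := ciSup_le fun p => (hdΨ p.1 p.2).trans (hΨle p.1 p.2)
  calc worstTvDist P π n ≤ (1 - ρ) ^ n * rhoDiam d := hmain
    _ ≤ (1 - ρ) ^ n * ((K + 1) * Fmax + C) := mul_le_mul_of_nonneg_left hdiam (pow_nonneg (by linarith) n)
    _ = ((K + 1) * Fmax + C) * (1 - ρ) ^ n := by ring

end Adjacent

section FiniteOddsAdjacent
variable {X : Type*} [Fintype X] [DecidableEq X] {S : Type*} [Fintype S] [DecidableEq S]
variable {hub : X → S} {comp : X → S → ℕ} {K : ℕ} {μ0 W θ : S → ℝ} {p σ ρ C c : ℝ} {acc : S → S → ℝ} {Kh : (S → ℕ) → S → S → ℝ}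
variable {u ut : X → S → ℝ} {qt q : X → X → S → S → ℝ}
variable {P : X → X → ℝ} {Q : Matrix (X × X) (X × X) ℝ} {Δ : (S → ℕ) → (S → ℕ) → ℕ} {F Ψ : X × X → ℝ}

/-- **THE CONDITIONAL LAW OF CHAPTER W FILE 7 WITH THE PERSISTENCE INEQUALITY ON ADJACENT EQUAL-HUB PAIRS ONLY:** `d(n) ≤ ((K+1)(c+2K+2) + 2(K+1)(c+2K+6))·(1−ρ)ⁿ`. [ours] -/
theorem finiteOdds_adjacent_worstTvDist_le [Nonempty X] (hinj : ∀ x x', hub x = hub x' → comp x = comp x' → x = x') (hsum : ∀ x, ∑ v, comp x v = K + 1)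
    (hsurj : ∀ (z : S) (N : S → ℕ), ∑ v, N v = K + 1 → N z ≠ 0 → ∃ x, hub x = z ∧ comp x = N) (hhub : ∀ x, comp x (hub x) ≠ 0) (hK : 1 ≤ K)
    (hW : ∀ v, 0 < W v) (hp0 : 0 ≤ p) (hp : ∀ v, p * W v ≤ 1) (hθ : ∀ v, θ v = 1 / (1 + p * W v)) (hacc : ∀ h v, acc h v = min 1 (W h / W v))
    (hμ0 : ∀ v, 0 ≤ μ0 v) (hμ1 : ∑ v, μ0 v = 1) (hc1 : 1 ≤ c) (hσ0 : 0 ≤ σ) (hσ1 : σ < 1) (hρ0 : 0 ≤ ρ) (hρ : ρ ≤ 1 / 2)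
    (hKoff : ∀ N h v, h ≠ v → Kh N h v = if N h = 0 then 0 else (N v : ℝ) / K * acc h v) (hKdiag : ∀ N h, Kh N h h = 1 - ∑ v ∈ univ.erase h, Kh N h v)
    (hu : ∀ x v, u x v = (1 - σ) * (if v = hub x then (1 : ℝ) else 0) + σ * ∑ h, u x h * Kh (comp x) h v)
    (hut : ∀ x v, ut x v = ∑ h, u x h * Kh (comp x) h v)
    (hqtc : ∀ x y, IsCoupling (ut x) (ut y) (qt x y))
    (hq : ∀ x y a b, q x y a b = (1 - σ) * ((if a = hub x then (1 : ℝ) else 0) * (if b = hub y then (1 : ℝ) else 0)) + σ * qt x y a b)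
    (hΔ : ∀ N N', Δ N N' = ∑ v, (N v - N' v))
    (hmono : ∀ x y, hub x = hub y → ∀ a b, qt x y a b ≠ 0 → Δ (comp x - Pi.single a 1) (comp y - Pi.single b 1) ≤ Δ (comp x) (comp y))
    (hP : ∀ x x', P x x' = ∑ a, u x a * (μ0 (hub x') * (if comp x' + Pi.single a 1 = comp x + Pi.single (hub x') 1 then (1 : ℝ) else 0)))
    (hQ : ∀ x y x' y', Q (x, y) (x', y') = ∑ a, ∑ b, q x y a b * (μ0 (hub x')
      * (if comp x' + Pi.single a 1 = comp x + Pi.single (hub x') 1 then (1 : ℝ) else 0))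
      * ((if hub y' = hub x' then (1 : ℝ) else 0) * (if comp y' + Pi.single b 1 = comp y + Pi.single (hub y') 1 then (1 : ℝ) else 0)))
    (hF : ∀ x y, F (x, y) = c + (-(1 - σ) * θ (hub x)) + (-(1 - σ) * θ (hub y)) + ∑ v, θ v * ((comp x v : ℝ) + (comp y v : ℝ)))
    (hC : C = 2 * ((K + 1) * (c + 2 * K + 6)))
    (hΨ : ∀ x y, Ψ (x, y) = (Δ (comp x) (comp y) : ℝ) * F (x, y) + C * (if hub x = hub y then (0 : ℝ) else 1))
    (hpers : ∀ x y, hub x = hub y → Δ (comp x) (comp y) = 1 →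
      ρ * (Δ (comp x) (comp y) : ℝ) * F (x, y)
        ≤ σ * (((Δ (comp x) (comp y) : ℝ) - ∑ a, ∑ b, qt x y a b * (Δ (comp x - Pi.single a 1) (comp y - Pi.single b 1) : ℝ))
              * (F (x, y) + (2 * (1 - σ) * θ (hub x) + 2 * σ * ∑ v, μ0 v * θ v) - 2)
            + p * (Δ (comp x) (comp y) : ℝ) * (2 * ∑ v, μ0 v * (W v * θ v) - ∑ a, ut x a * (W a * θ a) - ∑ b, ut y b * (W b * θ b))))
    {π : X → ℝ} (hπ : IsStationary π P) (hπ0 : ∀ x, 0 ≤ π x) (hπ1 : ∑ x, π x = 1) (n : ℕ) :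
    worstTvDist P π n ≤ ((K + 1) * (c + 2 * K + 2) + 2 * ((K + 1) * (c + 2 * K + 6))) * (1 - ρ) ^ n := by
  -- the end-hub laws (chapter W file 7 §1)
  have hu0 : ∀ x a, 0 ≤ u x a := finiteOdds_endHub_nonneg hW hacc hKoff hKdiag hK hsum hσ0 hσ1 hu
  have hu1 : ∀ x, ∑ a, u x a = 1 := finiteOdds_endHub_sum hKdiag hσ1 hu
  have hlegal : ∀ x a, u x a ≠ 0 → comp x a ≠ 0 := finiteOdds_endHub_legal hW hacc hKoff hKdiag hK hsum hhub hσ0 hσ1 hu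
  have hut1 : ∀ x, ∑ v, ut x v = 1 := finiteOdds_tail_sum hKdiag hσ1 hu hut
  have hdec : ∀ x v, u x v = (1 - σ) * (if v = hub x then (1 : ℝ) else 0) + σ * ut x v := fun x v => geomResolvent_decomp (hu x) (hut x) v
  have hqc : ∀ x y, IsCoupling (u x) (u y) (q x y) := fun x y =>
    mixture2_isCoupling hσ0 hσ1.le (hqtc x y) (hdec x) (hdec y) (hq x y)
  have hF1 : ∀ x y, 1 ≤ F (x, y) := fun x y => by linarith [finiteOdds_F_ge hW hp0 hp hθ hσ0 hhub hF x y]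
  have hFmax : ∀ x y, F (x, y) ≤ c + 2 * K + 2 := finiteOdds_F_le hW hp0 hp hθ hσ1 hsum hF
  have hK0 : (0 : ℝ) ≤ K := Nat.cast_nonneg _
  have hC1 : 1 ≤ C := by rw [hC]; nlinarith
  have hc0 : 0 ≤ c := by linarith
  have hBC : ((K : ℝ) + 1) * (c + 2 * K + 6) ≤ (1 - ρ) * C := by rw [hC]; nlinarith
  -- the criterion on adjacent equal-hub pairs (file 7's computation verbatim)
  have hcrit : ∀ x y, hub x = hub y → Δ (comp x) (comp y) = 1 → ∑ a, ∑ b, q x y a b * ((Δ (comp x - Pi.single a 1) (comp y - Pi.single b 1) : ℝ)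
        * (F (x, y) + (2 * ∑ v, μ0 v * (-(1 - σ) * θ v) - (-(1 - σ) * θ (hub x)) - (-(1 - σ) * θ (hub y)) + 2 * ∑ v, μ0 v * θ v) - θ a - θ b))
        ≤ (1 - ρ) * ((Δ (comp x) (comp y) : ℝ) * F (x, y)) := by
    intro x y hxy h1
    rw [hxy, finiteOdds_e_eq]
    have hz : comp x (hub y) ≠ 0 := hxy ▸ hhub x
    have hDz : (Δ (comp x - Pi.single (hub y) 1) (comp y - Pi.single (hub y) 1) : ℝ) = (Δ (comp x) (comp y) : ℝ) := by
      have ex := urnChain_survivor (comp x) hz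
      have ey := urnChain_survivor (comp y) (hhub y)
      have h := cdist_add_single_same hΔ (comp x - Pi.single (hub y) 1) (comp y - Pi.single (hub y) 1) (hub y)
      rw [← ex, ← ey] at h
      exact_mod_cast h.symm
    have h := finiteOdds_persistence_contract (z := hub y) (utX := ut x) (utY := ut y) (qt := qt x y) (q := q x y)
      (Dn := fun a b => (Δ (comp x - Pi.single a 1) (comp y - Pi.single b 1) : ℝ)) (D := (Δ (comp x) (comp y) : ℝ)) (Φ := F (x, y))
      (e := 2 * (1 - σ) * θ (hub y) + 2 * σ * ∑ v, μ0 v * θ v) (ρ := ρ)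
      hW hp0 hp hθ hμ1 hσ0 (hqtc x y) (hut1 x) (hut1 y) (fun a b => by rw [hq x y a b, hxy]) hDz
      (fun a b hab => by exact_mod_cast hmono x y hxy a b hab) rfl (by have := hpers x y hxy h1; rw [hxy] at this; exact this)
    calc _ = ∑ a, ∑ b, q x y a b * ((Δ (comp x - Pi.single a 1) (comp y - Pi.single b 1) : ℝ)
            * (F (x, y) + (2 * (1 - σ) * θ (hub y) + 2 * σ * ∑ v, μ0 v * θ v) - θ a - θ b)) := rfl
      _ ≤ (1 - ρ) * (Δ (comp x) (comp y) : ℝ) * F (x, y) := h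
      _ = (1 - ρ) * ((Δ (comp x) (comp y) : ℝ) * F (x, y)) := by ring
  have h := lumpedAdjacent_worstTvDist_le (c := c) (s := fun v => -(1 - σ) * θ v) (r := θ) (C := C) (Fmax := c + 2 * K + 2) hinj hsum hsurj hhub hμ0 hμ1 hu0 hu1
    hlegal hqc hΔ hP hQ hF hΨ hF1 hFmax hC1 (by linarith) hBC (finiteOdds_functional_le hW hp0 hp hθ hc0 hσ0 hσ1 hμ0 hμ1 hΔ hsum hqc hu1 hF) hcrit hπ hπ0 hπ1 n
  rw [hC] at h
  exact h

/-- **The same with the monotonicity of the tail coupling also required on adjacent pairs only** (elsewhere any couplings of the tail laws; appended GEN-37). [ours] -/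
theorem finiteOdds_adjacent_worstTvDist_le' [Nonempty X] (hinj : ∀ x x', hub x = hub x' → comp x = comp x' → x = x') (hsum : ∀ x, ∑ v, comp x v = K + 1)
    (hsurj : ∀ (z : S) (N : S → ℕ), ∑ v, N v = K + 1 → N z ≠ 0 → ∃ x, hub x = z ∧ comp x = N) (hhub : ∀ x, comp x (hub x) ≠ 0) (hK : 1 ≤ K)
    (hW : ∀ v, 0 < W v) (hp0 : 0 ≤ p) (hp : ∀ v, p * W v ≤ 1) (hθ : ∀ v, θ v = 1 / (1 + p * W v)) (hacc : ∀ h v, acc h v = min 1 (W h / W v))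
    (hμ0 : ∀ v, 0 ≤ μ0 v) (hμ1 : ∑ v, μ0 v = 1) (hc1 : 1 ≤ c) (hσ0 : 0 ≤ σ) (hσ1 : σ < 1) (hρ0 : 0 ≤ ρ) (hρ : ρ ≤ 1 / 2)
    (hKoff : ∀ N h v, h ≠ v → Kh N h v = if N h = 0 then 0 else (N v : ℝ) / K * acc h v) (hKdiag : ∀ N h, Kh N h h = 1 - ∑ v ∈ univ.erase h, Kh N h v)
    (hu : ∀ x v, u x v = (1 - σ) * (if v = hub x then (1 : ℝ) else 0) + σ * ∑ h, u x h * Kh (comp x) h v)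
    (hut : ∀ x v, ut x v = ∑ h, u x h * Kh (comp x) h v)
    (hqtc : ∀ x y, IsCoupling (ut x) (ut y) (qt x y))
    (hq : ∀ x y a b, q x y a b = (1 - σ) * ((if a = hub x then (1 : ℝ) else 0) * (if b = hub y then (1 : ℝ) else 0)) + σ * qt x y a b)
    (hΔ : ∀ N N', Δ N N' = ∑ v, (N v - N' v))
    (hmono : ∀ x y, hub x = hub y → Δ (comp x) (comp y) = 1 → ∀ a b, qt x y a b ≠ 0 → Δ (comp x - Pi.single a 1) (comp y - Pi.single b 1) ≤ Δ (comp x) (comp y))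
    (hP : ∀ x x', P x x' = ∑ a, u x a * (μ0 (hub x') * (if comp x' + Pi.single a 1 = comp x + Pi.single (hub x') 1 then (1 : ℝ) else 0)))
    (hQ : ∀ x y x' y', Q (x, y) (x', y') = ∑ a, ∑ b, q x y a b * (μ0 (hub x')
      * (if comp x' + Pi.single a 1 = comp x + Pi.single (hub x') 1 then (1 : ℝ) else 0))
      * ((if hub y' = hub x' then (1 : ℝ) else 0) * (if comp y' + Pi.single b 1 = comp y + Pi.single (hub y') 1 then (1 : ℝ) else 0)))
    (hF : ∀ x y, F (x, y) = c + (-(1 - σ) * θ (hub x)) + (-(1 - σ) * θ (hub y)) + ∑ v, θ v * ((comp x v : ℝ) + (comp y v : ℝ)))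
    (hC : C = 2 * ((K + 1) * (c + 2 * K + 6)))
    (hΨ : ∀ x y, Ψ (x, y) = (Δ (comp x) (comp y) : ℝ) * F (x, y) + C * (if hub x = hub y then (0 : ℝ) else 1))
    (hpers : ∀ x y, hub x = hub y → Δ (comp x) (comp y) = 1 →
      ρ * (Δ (comp x) (comp y) : ℝ) * F (x, y)
        ≤ σ * (((Δ (comp x) (comp y) : ℝ) - ∑ a, ∑ b, qt x y a b * (Δ (comp x - Pi.single a 1) (comp y - Pi.single b 1) : ℝ))
              * (F (x, y) + (2 * (1 - σ) * θ (hub x) + 2 * σ * ∑ v, μ0 v * θ v) - 2)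
            + p * (Δ (comp x) (comp y) : ℝ) * (2 * ∑ v, μ0 v * (W v * θ v) - ∑ a, ut x a * (W a * θ a) - ∑ b, ut y b * (W b * θ b))))
    {π : X → ℝ} (hπ : IsStationary π P) (hπ0 : ∀ x, 0 ≤ π x) (hπ1 : ∑ x, π x = 1) (n : ℕ) :
    worstTvDist P π n ≤ ((K + 1) * (c + 2 * K + 2) + 2 * ((K + 1) * (c + 2 * K + 6))) * (1 - ρ) ^ n := by
  -- the end-hub laws (chapter W file 7 §1)
  have hu0 : ∀ x a, 0 ≤ u x a := finiteOdds_endHub_nonneg hW hacc hKoff hKdiag hK hsum hσ0 hσ1 hu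
  have hu1 : ∀ x, ∑ a, u x a = 1 := finiteOdds_endHub_sum hKdiag hσ1 hu
  have hlegal : ∀ x a, u x a ≠ 0 → comp x a ≠ 0 := finiteOdds_endHub_legal hW hacc hKoff hKdiag hK hsum hhub hσ0 hσ1 hu
  have hut1 : ∀ x, ∑ v, ut x v = 1 := finiteOdds_tail_sum hKdiag hσ1 hu hut
  have hdec : ∀ x v, u x v = (1 - σ) * (if v = hub x then (1 : ℝ) else 0) + σ * ut x v := fun x v => geomResolvent_decomp (hu x) (hut x) v
  have hqc : ∀ x y, IsCoupling (u x) (u y) (q x y) := fun x y =>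
    mixture2_isCoupling hσ0 hσ1.le (hqtc x y) (hdec x) (hdec y) (hq x y)
  have hF1 : ∀ x y, 1 ≤ F (x, y) := fun x y => by linarith [finiteOdds_F_ge hW hp0 hp hθ hσ0 hhub hF x y]
  have hFmax : ∀ x y, F (x, y) ≤ c + 2 * K + 2 := finiteOdds_F_le hW hp0 hp hθ hσ1 hsum hF
  have hK0 : (0 : ℝ) ≤ K := Nat.cast_nonneg _
  have hC1 : 1 ≤ C := by rw [hC]; nlinarith
  have hc0 : 0 ≤ c := by linarith
  have hBC : ((K : ℝ) + 1) * (c + 2 * K + 6) ≤ (1 - ρ) * C := by rw [hC]; nlinarith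
  -- the criterion on adjacent equal-hub pairs (file 7's computation verbatim)
  have hcrit : ∀ x y, hub x = hub y → Δ (comp x) (comp y) = 1 → ∑ a, ∑ b, q x y a b * ((Δ (comp x - Pi.single a 1) (comp y - Pi.single b 1) : ℝ)
        * (F (x, y) + (2 * ∑ v, μ0 v * (-(1 - σ) * θ v) - (-(1 - σ) * θ (hub x)) - (-(1 - σ) * θ (hub y)) + 2 * ∑ v, μ0 v * θ v) - θ a - θ b))
        ≤ (1 - ρ) * ((Δ (comp x) (comp y) : ℝ) * F (x, y)) := by
    intro x y hxy h1
    rw [hxy, finiteOdds_e_eq]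
    have hz : comp x (hub y) ≠ 0 := hxy ▸ hhub x
    have hDz : (Δ (comp x - Pi.single (hub y) 1) (comp y - Pi.single (hub y) 1) : ℝ) = (Δ (comp x) (comp y) : ℝ) := by
      have ex := urnChain_survivor (comp x) hz
      have ey := urnChain_survivor (comp y) (hhub y)
      have h := cdist_add_single_same hΔ (comp x - Pi.single (hub y) 1) (comp y - Pi.single (hub y) 1) (hub y)
      rw [← ex, ← ey] at h
      exact_mod_cast h.symm
    have h := finiteOdds_persistence_contract (z := hub y) (utX := ut x) (utY := ut y) (qt := qt x y) (q := q x y)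
      (Dn := fun a b => (Δ (comp x - Pi.single a 1) (comp y - Pi.single b 1) : ℝ)) (D := (Δ (comp x) (comp y) : ℝ)) (Φ := F (x, y))
      (e := 2 * (1 - σ) * θ (hub y) + 2 * σ * ∑ v, μ0 v * θ v) (ρ := ρ)
      hW hp0 hp hθ hμ1 hσ0 (hqtc x y) (hut1 x) (hut1 y) (fun a b => by rw [hq x y a b, hxy]) hDz
      (fun a b hab => by exact_mod_cast hmono x y hxy h1 a b hab) rfl (by have := hpers x y hxy h1; rw [hxy] at this; exact this)
    calc _ = ∑ a, ∑ b, q x y a b * ((Δ (comp x - Pi.single a 1) (comp y - Pi.single b 1) : ℝ)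
            * (F (x, y) + (2 * (1 - σ) * θ (hub y) + 2 * σ * ∑ v, μ0 v * θ v) - θ a - θ b)) := rfl
      _ ≤ (1 - ρ) * (Δ (comp x) (comp y) : ℝ) * F (x, y) := h
      _ = (1 - ρ) * ((Δ (comp x) (comp y) : ℝ) * F (x, y)) := by ring
  have h := lumpedAdjacent_worstTvDist_le (c := c) (s := fun v => -(1 - σ) * θ v) (r := θ) (C := C) (Fmax := c + 2 * K + 2) hinj hsum hsurj hhub hμ0 hμ1 hu0 hu1
    hlegal hqc hΔ hP hQ hF hΨ hF1 hFmax hC1 (by linarith) hBC (finiteOdds_functional_le hW hp0 hp hθ hc0 hσ0 hσ1 hμ0 hμ1 hΔ hsum hqc hu1 hF) hcrit hπ hπ0 hπ1 n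
  rw [hC] at h
  exact h

end FiniteOddsAdjacent

end Summit.Ventures.LatticeQCDFlow.Scaling
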